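import Summits.CriticalPhenomena.PercolationContinuityZ3.Theorems.PercNearOneGluingNoHeavyLowerTailOneCutCertMain
import Summits.CriticalPhenomena.PercolationContinuityZ3.Theorems.PercNearOneGluingNoHeavyLowerTailOneCutCertSound
import Summits.CriticalPhenomena.PercolationContinuityZ3.Theorems.PercNearOneGluingNoHeavyLowerTailOneCutCertBoxHHHHH
import Summits.CriticalPhenomena.PercolationContinuityZ3.Theorems.PercNearOneGluingNoHeavyLowerTailOneCutCertBoxHHHHL
import Summits.CriticalPhenomena.PercolationContinuityZ3.Theorems.PercNearOneGluingNoHeavyLowerTailOneCutCertBoxHHHLL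
import Summits.CriticalPhenomena.PercolationContinuityZ3.Theorems.PercNearOneGluingNoHeavyLowerTailOneCutCertBoxHHLLL
import Summits.CriticalPhenomena.PercolationContinuityZ3.Theorems.PercNearOneGluingNoHeavyLowerTailOneCutCertBoxHLLLL
import Summits.CriticalPhenomena.PercolationContinuityZ3.Theorems.PercNearOneGluingNoHeavyLowerTailOneCutCertBoxLLLLL
import Summits.CriticalPhenomena.PercolationContinuityZ3.Theorems.PercNearOneGluingNoHeavyLowerTailOneCutCertK5oA
import Summits.CriticalPhenomena.PercolationContinuityZ3.Theorems.PercNearOneGluingNoHeavyLowerTailOneCutCertK6oA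

/-!
# `NoHeavyLowerTail` (crux stmt-CriticalPhenomena-4575): **ONE-CUT at `|A| = 5` for every weighted
# graph on at most six vertices** — `oneCut5_le_six`

Final assembly (prim-cert-2, certificate miner #2, even `N`; here `N = 6`).  COMPUTATIONAL ancestry: the
eight certificate instances `…OneCutCertBox{HHHHH,HHHHL,HHHLL,HHLLL,HLLLL,LLLLL}`, `…K5oA`, `…K6oA` are
checked by `native_decide`; everything else (`…CertAlgebra/Kronecker/Tables/Graph/Check/Sound/Assembly/Main`)
is ordinary kernel-checked mathematics.  The statement is the registered stub `stub_oneCut` of the line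
`fkg-relay` restricted to `n ≤ 6` and `A.card = 5`:

  for all `w : Sym2 (Fin n) → [0,1]`, `|A| = 5`, `o`, `t ≥ 0`: if `P(a ↮ a') ≤ t` for all `a ≠ a' ∈ A` then
  `P(1 ≤ N < E N / 2) ≤ t`, `N = #{a ∈ A : o ↔ a}`.
-/

namespace Summit.CriticalPhenomena.PercolationContinuityZ3.Theorems

open MeasureTheory
open scoped BigOperators Classical
open Literature.Probability.Percolation Literature.Probability.LatticeModels

namespace OneCutCert

/-- The box of instance `BoxHHHHH` is the canonical pattern `5`. [this work] -/
theorem boxBoxHHHHH_eq : boxBoxHHHHH = boxPat 5 := by decide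

/-- `BoxOK 5` (via `boxCheck_sound`; COMPUTATIONAL ancestry: `checkBoxHHHHH_true`). [this work] -/
theorem boxOK_5 : BoxOK 5 := by
  intro w hbox hEN t hcut
  exact boxCheck_sound 0 relBoxHHHHH (by decide) (relPairs relBoxHHHHH) boxBoxHHHHH _ lamTBoxHHHHH ccTBoxHHHHH
    checkBoxHHHHH_true w (by rw [boxBoxHHHHH_eq]; exact hbox) hEN t hcut
/-- The box of instance `BoxHHHHL` is the canonical pattern `4`. [this work] -/
theorem boxBoxHHHHL_eq : boxBoxHHHHL = boxPat 4 := by decide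

/-- `BoxOK 4` (via `boxCheck_sound`; COMPUTATIONAL ancestry: `checkBoxHHHHL_true`). [this work] -/
theorem boxOK_4 : BoxOK 4 := by
  intro w hbox hEN t hcut
  exact boxCheck_sound 0 relBoxHHHHL (by decide) (relPairs relBoxHHHHL) boxBoxHHHHL _ lamTBoxHHHHL ccTBoxHHHHL
    checkBoxHHHHL_true w (by rw [boxBoxHHHHL_eq]; exact hbox) hEN t hcut
/-- The box of instance `BoxHHHLL` is the canonical pattern `3`. [this work] -/
theorem boxBoxHHHLL_eq : boxBoxHHHLL = boxPat 3 := by decide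

/-- `BoxOK 3` (via `boxCheck_sound`; COMPUTATIONAL ancestry: `checkBoxHHHLL_true`). [this work] -/
theorem boxOK_3 : BoxOK 3 := by
  intro w hbox hEN t hcut
  exact boxCheck_sound 0 relBoxHHHLL (by decide) (relPairs relBoxHHHLL) boxBoxHHHLL _ lamTBoxHHHLL ccTBoxHHHLL
    checkBoxHHHLL_true w (by rw [boxBoxHHHLL_eq]; exact hbox) hEN t hcut
/-- The box of instance `BoxHHLLL` is the canonical pattern `2`. [this work] -/
theorem boxBoxHHLLL_eq : boxBoxHHLLL = boxPat 2 := by decide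

/-- `BoxOK 2` (via `boxCheck_sound`; COMPUTATIONAL ancestry: `checkBoxHHLLL_true`). [this work] -/
theorem boxOK_2 : BoxOK 2 := by
  intro w hbox hEN t hcut
  exact boxCheck_sound 0 relBoxHHLLL (by decide) (relPairs relBoxHHLLL) boxBoxHHLLL _ lamTBoxHHLLL ccTBoxHHLLL
    checkBoxHHLLL_true w (by rw [boxBoxHHLLL_eq]; exact hbox) hEN t hcut
/-- The box of instance `BoxHLLLL` is the canonical pattern `1`. [this work] -/
theorem boxBoxHLLLL_eq : boxBoxHLLLL = boxPat 1 := by decide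

/-- `BoxOK 1` (via `boxCheck_sound`; COMPUTATIONAL ancestry: `checkBoxHLLLL_true`). [this work] -/
theorem boxOK_1 : BoxOK 1 := by
  intro w hbox hEN t hcut
  exact boxCheck_sound 0 relBoxHLLLL (by decide) (relPairs relBoxHLLLL) boxBoxHLLLL _ lamTBoxHLLLL ccTBoxHLLLL
    checkBoxHLLLL_true w (by rw [boxBoxHLLLL_eq]; exact hbox) hEN t hcut
/-- The box of instance `BoxLLLLL` is the canonical pattern `0`. [this work] -/
theorem boxBoxLLLLL_eq : boxBoxLLLLL = boxPat 0 := by decide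

/-- `BoxOK 0` (via `boxCheck_sound`; COMPUTATIONAL ancestry: `checkBoxLLLLL_true`). [this work] -/
theorem boxOK_0 : BoxOK 0 := by
  intro w hbox hEN t hcut
  exact boxCheck_sound 0 relBoxLLLLL (by decide) (relPairs relBoxLLLLL) boxBoxLLLLL _ lamTBoxLLLLL ccTBoxLLLLL
    checkBoxLLLLL_true w (by rw [boxBoxLLLLL_eq]; exact hbox) hEN t hcut

/-- All six canonical boxes. [this work] -/
theorem boxOK_all : ∀ k, k ≤ 5 → BoxOK k := by
  intro k hk
  interval_cases k
  · exact boxOK_0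
  · exact boxOK_1
  · exact boxOK_2
  · exact boxOK_3
  · exact boxOK_4
  · exact boxOK_5

/-- The box of `K5oA` is the full cube. [this work] -/
theorem boxK5oA_eq : ∀ i, boxK5oA i = 0 := by decide

/-- The box of `K6oA` is the full cube. [this work] -/
theorem boxK6oA_eq : ∀ i, boxK6oA i = 0 := by decide

/-- `CanonOK 5` (COMPUTATIONAL ancestry: `checkK5oA_true`). [this work] -/
theorem canonOK5 : CanonOK 5 [0, 1, 2, 3, 4] 0 := by
  intro w hbox hEN t hcut
  refine boxCheck_sound 0 relK5oA (by decide) (relPairs relK5oA) boxK5oA _ lamTK5oA ccTK5oA checkK5oA_true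
    w (fun i => ?_) hEN t hcut
  rw [boxK5oA_eq i]; unfold loOf hiOf; norm_num; exact hbox i

/-- `CanonOK 6` (COMPUTATIONAL ancestry: `checkK6oA_true`). [this work] -/
theorem canonOK6 : CanonOK 6 [0, 1, 2, 3, 4] 0 := by
  intro w hbox hEN t hcut
  refine boxCheck_sound 0 relK6oA (by decide) (relPairs relK6oA) boxK6oA _ lamTK6oA ccTK6oA checkK6oA_true
    w (fun i => ?_) hEN t hcut
  rw [boxK6oA_eq i]; unfold loOf hiOf; norm_num; exact hbox i

end OneCutCert

open OneCutCert in
/-- **ONE-CUT at `|A| = 5` on at most six vertices.**  For every `n ≤ 6`, every weight vector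
`w : Sym2 (Fin n) → [0,1]`, every relay set `A` with `|A| = 5`, every observer `o` and every `t ≥ 0`
bounding all relay–relay cuts `P(a ↮ a')`, `a ≠ a' ∈ A`:  `P(1 ≤ N < E N/2) ≤ t`
(registered stub `oneCut5_le_six` of stmt-CriticalPhenomena-4575; COMPUTATIONAL: rests on eight
`native_decide` certificate checks; prim-cert-2). [this work] -/
theorem oneCut5_le_six : ∀ (n : ℕ), n ≤ 6 → ∀ (w : Sym2 (Fin n) → unitInterval) (A : Finset (Fin n)) (o : Fin n) (t : ℝ), A.card = 5 → 0 ≤ t → (∀ a ∈ A, ∀ a' ∈ A, a ≠ a' → (Literature.Probability.LatticeModels.prodBernoulli w).real (Literature.Probability.Percolation.openConn a a')ᶜ ≤ t) → (Literature.Probability.LatticeModels.prodBernoulli w).real {ω : Literature.Probability.Percolation.BondConfig (Fin n) | 1 ≤ (A.filter fun a => ω ∈ Literature.Probability.Percolation.openConn o a).card ∧ ((A.filter fun a => ω ∈ Literature.Probability.Percolation.openConn o a).card : ℝ) < (∑ a ∈ A, (Literature.Probability.LatticeModels.prodBernoulli w).real (Literature.Probability.Percolation.openConn o a)) / 2} ≤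 t :=
  oneCut5_le_six_of boxOK_all canonOK5 canonOK6

end Summit.CriticalPhenomena.PercolationContinuityZ3.Theorems
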